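import Summits.CriticalPhenomena.PercolationContinuityZ3.Theorems.SahiMasterFamilyUCBernsteinRootable
import Summits.CriticalPhenomena.PercolationContinuityZ3.Theorems.SahiMasterFamilyPhiScale

/-!
# STAR ABSORPTION: the edge polynomial of `(𝒢, 𝒱)` is Bernstein-positive whenever `𝒢` contains the star of a point and `𝒱` is
# union-closed — every order, `𝒢` otherwise arbitrary

Unit `prim-masterthm-p4` (gen 26; crux anchor stmt-CriticalPhenomena-4575, helper work; memo
`run/shared/lean/prim/prim-masterthm/prim-masterthm-p4/P4-GEN26-REPORT.md` §1–§2).  Companion of `…BernsteinPos` (`BPos`, `mix`, `comap`,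
the block expansion `Φ(β) = Σ_{B ∋ last} (|B|−1)!·β_B·κ_B` at the last index for every real `β`, `coRest_congr_off_last`),
`…UCBernsteinNested` (`exists_emb_coRest'`: `−κ_B` is the edge polynomial of the pair pulled back to `univ ∖ B`) and `…UCBernsteinRootable`
(conjecture (B) for ROOTABLE pairs).

SETTING.  `T = Fin (n+1)`, two families `𝒢, 𝒱` of subsets of `T`, the EDGE POLYNOMIAL `P_T(w) = Φ_{n+1}(w·1_𝒢 + (1−w)·1_𝒱)`
(`phiSet ∘ mix`), `BPos (n+1)` = all degree-`(n+1)` Bernstein coefficients `≥ 0` (the layer sums of conjecture (B)).  The STAR of a point `z` is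
`{S ⊆ T : z ∈ S}`.

**THEOREM (`bpos_phiSet_mix_of_star`, every order).**  If `𝒱` is union-closed (top optional) and `𝒢` is ANY family containing every set
through `z` (`𝒢 ⊇ star z`), then `P_T(𝒢, 𝒱)` is `BPos (n+1)`.

WHY IT MATTERS (memo §1): for a pair `(𝒰, 𝒱)` and a root `z` the block expansion at `z` reads
`P_T(𝒰,𝒱) = P_T(𝒰 ∪ star z, 𝒱) + Σ_{B ∋ z, B ∉ 𝒰, B ≠ T} (|B|−1)!·w·P_{T∖B}(𝒰|,𝒱|) − [T ∉ 𝒰](|T|−1)!·w`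
(the two expansions share `W^{(z)}` and the complementary factors), i.e. the cap term `W^{(z)}` ABSORBS every block term whose block lies
outside `𝒱` only — the `(1−w)`-half of the defect factors — into one Bernstein-positive quantity `P_T(𝒰 ∪ star z, 𝒱)`; what is left are the
blocks outside `𝒰`, weighted by `w`.  This halves the negative terms of the gen-22 induction (file `…HalfRootable`).

PROOF (memo §2; the paper proof is the identity `P_T(𝒢,𝒱) = Σ_{X ∋ z} P_X(2^X, 𝒱|_X)·a_𝒢(T∖X)` with `a_𝒢 ≥_B 0` the generating polynomial of
`𝒢`-avoiding permutations; the kernel proof avoids generating functions):  descend from `𝒢 = 2^T` to `𝒢` by deleting the missing sets one at a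
time.  (i) BASE: the pair `(2^T, 𝒱)` is ROOTABLE (`rootable_univ_left`: at a top in `𝒱` every block outside `𝒱` has a restriction of the same
kind; at a top outside `𝒱` root at a point in no member of `𝒱`, which exists by union-closure, and no block lies outside `2^T`), hence `BPos` by
`UCBernsteinRootable.bpos_phiSet_mix_of_rootable`.  (ii) STEP (`phiSet_mix_erase`): deleting one set `S ∌ z`, `∅ ≠ S ≠ T`, from `𝒢` changes
`Φ` affinely: `P_T(𝒢 ∖ {S}, 𝒱) = P_T(𝒢, 𝒱) + (|S|−1)!·w·P_{T∖S}(𝒢|,𝒱|)` (block expansion at a point of `S`; only the block `S` changes, its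
complementary factor does not), and the restricted pair again contains the star of `z ∈ T ∖ S`, so its edge polynomial is `BPos` by induction
on the order; `S = ∅` changes nothing (`phiSet` never evaluates the empty block).
HONEST FRAMING: a structural positivity theorem, every order; conjecture (B) for general pairs, `UCHullNonneg k` (k ≥ 8), Sahi's `C_k` and the
master theorem remain OPEN.  Axioms standard. [this work]
-/

noncomputable section

open scoped Classical

namespace Summit.CriticalPhenomena.PercolationContinuityZ3.Theorems

namespace StarAbsorption

open Finset Function Equiv
open Literature.Combinatorics.Sahi2008
open Literature.Combinatorics.Sahi2008.CycleForm
open PrincipalCapBeta (phiSet realF realW)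
open BernsteinPos UCBernsteinNested UCBernsteinRootable

variable {n : ℕ}

/-! ### The full family is rootable against every union-closed family -/

/-- Pulling back the full family gives the full family. [this work] -/
theorem comap_univ {m : ℕ} (e : Fin m ↪ Fin n) :
    comap e (univ : Finset (Finset (Fin n))) = (univ : Finset (Finset (Fin m))) := by
  ext S
  rw [mem_comap]
  exact ⟨fun _ => mem_univ _, fun _ => mem_univ _⟩

/-- The order drops along the complementary embedding of a nonempty block. [this work] -/
theorem lt_of_map_univ_eq_sdiff {m : ℕ} {B : Finset (Fin (n + 1))} {x : Fin (n + 1)} (hxB : x ∈ B)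
    (e : Fin (m + 1) ↪ Fin (n + 1)) (he : (univ : Finset (Fin (m + 1))).map e = univ \ B) : m < n := by
  have hcard : (univ \ B).card = m + 1 := by rw [← he, card_map, card_univ, Fintype.card_fin]
  have hlt : (univ \ B).card < (univ : Finset (Fin (n + 1))).card :=
    card_lt_card ⟨sdiff_subset, fun hsub => (mem_sdiff.1 (hsub (mem_univ x))).2 hxB⟩
  rw [hcard, card_univ, Fintype.card_fin] at hlt
  omega

/-- **The pair `(2^T, 𝒱)` is rootable** for every union-closed `𝒱` (top optional). [this work] -/
theorem rootable_univ_left : ∀ (n : ℕ) (𝒱 : Finset (Finset (Fin (n + 1)))),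
    (∀ A ∈ 𝒱, ∀ B ∈ 𝒱, A ∪ B ∈ 𝒱) → Rootable n (univ : Finset (Finset (Fin (n + 1)))) 𝒱 := by
  intro n
  induction n using Nat.strong_induction_on with
  | _ n ih =>
  intro 𝒱 hV
  by_cases htop : (univ : Finset (Fin (n + 1))) ∈ 𝒱
  · refine Rootable.both (Fin.last n) (mem_univ _) htop fun B hzB _ _ m e he => ?_
    rw [comap_univ]
    exact ih m (lt_of_map_univ_eq_sdiff hzB e he) _ (comap_unionClosed e 𝒱 hV)
  · obtain ⟨t, ht⟩ := PhiSegment.exists_forall_notMem 𝒱 hV htop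
    exact Rootable.left t (mem_univ _) htop ht fun B _ hBU => absurd (mem_univ B) hBU

/-- Base of the descent: `P_T(2^T, 𝒱)` is Bernstein-positive for union-closed `𝒱`. [this work] -/
theorem bpos_phiSet_mix_univ (𝒱 : Finset (Finset (Fin (n + 1)))) (hV : ∀ A ∈ 𝒱, ∀ B ∈ 𝒱, A ∪ B ∈ 𝒱) :
    BPos (n + 1) (fun w => phiSet (n + 1) (mix (univ : Finset (Finset (Fin (n + 1)))) 𝒱 w)) :=
  bpos_phiSet_mix_of_rootable (rootable_univ_left n 𝒱 hV) (fun _ _ _ _ => mem_univ _) hV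

/-! ### Deleting one set from the first family: an affine change of the edge polynomial -/

/-- Pull-back of `𝒢 ∖ {S}` along a permutation. [this work] -/
theorem comap_perm_erase (σ : Perm (Fin (n + 1))) (𝒢 : Finset (Finset (Fin (n + 1)))) (S : Finset (Fin (n + 1))) :
    comap σ.toEmbedding (𝒢.erase S) = (comap σ.toEmbedding 𝒢).erase (S.map σ.symm.toEmbedding) := by
  ext X
  rw [mem_comap, mem_erase, mem_erase, mem_comap]
  have key : X.map σ.toEmbedding = S ↔ X = S.map σ.symm.toEmbedding := by
    constructor
    · intro h; rw [← h, Finset.map_map]; ext x; simp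
    · intro h; rw [h, Finset.map_map]; ext x; simp
  rw [ne_eq, ne_eq, key]

/-- Deleting `S` from the first family does not change the mixture at any other set. [this work] -/
theorem mix_erase_of_ne {𝒢 𝒱 : Finset (Finset (Fin (n + 1)))} {S X : Finset (Fin (n + 1))} (hXS : X ≠ S) (w : ℝ) :
    mix (𝒢.erase S) 𝒱 w X = mix 𝒢 𝒱 w X := by
  unfold mix
  by_cases hXG : X ∈ 𝒢
  · rw [if_pos (mem_erase.2 ⟨hXS, hXG⟩), if_pos hXG]
  · rw [if_neg (fun h => hXG (mem_erase.1 h).2), if_neg hXG]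

/-- At the last index: deleting a block `S ∋ last` from the first family lowers `Φ` by `(|S|−1)!·w·κ_S`. [this work] -/
theorem phiSet_mix_erase_last (𝒢 𝒱 : Finset (Finset (Fin (n + 1)))) {S : Finset (Fin (n + 1))} (hS : S ∈ 𝒢)
    (hl : Fin.last n ∈ S) (w : ℝ) :
    phiSet (n + 1) (mix (𝒢.erase S) 𝒱 w) =
      phiSet (n + 1) (mix 𝒢 𝒱 w) - ((S.card - 1).factorial : ℝ) * (w * coRest (realW (mix 𝒢 𝒱 w)) realF S) := by
  have hoff : ∀ X : Finset (Fin (n + 1)), Fin.last n ∉ X → mix (𝒢.erase S) 𝒱 w X = mix 𝒢 𝒱 w X :=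
    fun X hX => mix_erase_of_ne (fun h : X = S => hX (h ▸ hl)) w
  rw [phiSet_eq_sum_blocks_last (mix (𝒢.erase S) 𝒱 w), phiSet_eq_sum_blocks_last (mix 𝒢 𝒱 w)]
  have hSmem : S ∈ univ.filter (fun B : Finset (Fin (n + 1)) => Fin.last n ∈ B) := mem_filter.2 ⟨mem_univ _, hl⟩
  rw [← Finset.add_sum_erase _ _ hSmem, ← Finset.add_sum_erase _ _ hSmem]
  have hrest : ∑ B ∈ (univ.filter (fun B : Finset (Fin (n + 1)) => Fin.last n ∈ B)).erase S,
      ((B.card - 1).factorial : ℝ) * (mix (𝒢.erase S) 𝒱 w B * coRest (realW (mix (𝒢.erase S) 𝒱 w)) realF B) =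
      ∑ B ∈ (univ.filter (fun B : Finset (Fin (n + 1)) => Fin.last n ∈ B)).erase S,
      ((B.card - 1).factorial : ℝ) * (mix 𝒢 𝒱 w B * coRest (realW (mix 𝒢 𝒱 w)) realF B) := by
    refine sum_congr rfl fun B hB => ?_
    have hBS : B ≠ S := (mem_erase.1 hB).1
    have hlB : Fin.last n ∈ B := (mem_filter.1 (mem_erase.1 hB).2).2
    rw [mix_erase_of_ne hBS w, coRest_congr_off_last hoff hlB]
  rw [hrest, coRest_congr_off_last hoff hl]
  have eS : mix (𝒢.erase S) 𝒱 w S = mix 𝒢 𝒱 w S - w := by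
    unfold mix
    rw [if_neg (fun h => (mem_erase.1 h).1 rfl), if_pos hS]
    ring
  rw [eS]
  ring

/-- **Deleting one proper nonempty set from the first family** (general position): there is an enumeration `f` of `T ∖ S` with
`P_T(𝒢 ∖ {S}, 𝒱)(w) = P_T(𝒢, 𝒱)(w) + (|S|−1)!·w·P_{T∖S}(𝒢|, 𝒱|)(w)` for every `w`. [this work] -/
theorem phiSet_mix_erase (𝒢 𝒱 : Finset (Finset (Fin (n + 1)))) {S : Finset (Fin (n + 1))} (hS : S ∈ 𝒢)
    {y : Fin (n + 1)} (hy : y ∈ S) (hSu : S ≠ univ) :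
    ∃ (m : ℕ) (f : Fin (m + 1) ↪ Fin (n + 1)), (univ : Finset (Fin (m + 1))).map f = univ \ S ∧
      ∀ w : ℝ, phiSet (n + 1) (mix (𝒢.erase S) 𝒱 w) =
        phiSet (n + 1) (mix 𝒢 𝒱 w) + ((S.card - 1).factorial : ℝ) * (w * phiSet (m + 1) (mix (comap f 𝒢) (comap f 𝒱) w)) := by
  let σ : Perm (Fin (n + 1)) := Equiv.swap y (Fin.last n)
  have hσy : σ y = Fin.last n := Equiv.swap_apply_left _ _
  have hσσ : σ.symm = σ := Equiv.symm_swap _ _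
  set 𝒢' := comap σ.toEmbedding 𝒢 with hG'
  set 𝒱' := comap σ.toEmbedding 𝒱 with hV'
  set S' : Finset (Fin (n + 1)) := S.map σ.symm.toEmbedding with hS'def
  have hS'map : S'.map σ.toEmbedding = S := by
    rw [hS'def, Finset.map_map]; ext x; simp
  have hS' : S' ∈ 𝒢' := by rw [hG', mem_comap, hS'map]; exact hS
  have hl : Fin.last n ∈ S' := by
    rw [hS'def, mem_map]; exact ⟨y, hy, by rw [hσσ]; exact hσy⟩
  have hS'u : S' ≠ univ := by
    intro h
    apply hSu
    have hc := congrArg Finset.card h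
    rw [hS'def, card_map, card_univ] at hc
    exact eq_univ_of_card _ hc
  obtain ⟨m, e, he, hsurj, hc⟩ := exists_emb_coRest' hS'u
  have hrange := map_univ_eq_sdiff e he hsurj
  refine ⟨m, e.trans σ.toEmbedding, ?_, fun w => ?_⟩
  · rw [map_univ_trans_perm e σ S' hrange, hS'map]
  have hcard : S'.card = S.card := by rw [hS'def, card_map]
  calc phiSet (n + 1) (mix (𝒢.erase S) 𝒱 w)
      = phiSet (n + 1) (mix (comap σ.toEmbedding (𝒢.erase S)) (comap σ.toEmbedding 𝒱) w) :=
        (phiSet_mix_comap_perm σ _ _ w).symm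
    _ = phiSet (n + 1) (mix (𝒢'.erase S') 𝒱' w) := by rw [comap_perm_erase, hG', hV', hS'def]
    _ = phiSet (n + 1) (mix 𝒢' 𝒱' w) - ((S'.card - 1).factorial : ℝ) * (w * coRest (realW (mix 𝒢' 𝒱' w)) realF S') :=
        phiSet_mix_erase_last 𝒢' 𝒱' hS' hl w
    _ = phiSet (n + 1) (mix 𝒢 𝒱 w) + ((S.card - 1).factorial : ℝ) *
          (w * phiSet (m + 1) (mix (comap (e.trans σ.toEmbedding) 𝒢) (comap (e.trans σ.toEmbedding) 𝒱) w)) := by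
        rw [hcard, hc, mix_map, hG', hV', comap_comap, comap_comap, phiSet_mix_comap_perm σ 𝒢 𝒱 w]
        ring

/-! ### The theorem -/

/-- **STAR ABSORPTION (every order).**  `𝒱` union-closed (top optional), `𝒢 ⊇ star z` arbitrary otherwise ⇒ the edge polynomial
`w ↦ Φ_{n+1}(w·1_𝒢 + (1−w)·1_𝒱)` is `BPos (n+1)`. [this work] -/
theorem bpos_phiSet_mix_of_star : ∀ (n : ℕ) (𝒢 𝒱 : Finset (Finset (Fin (n + 1)))) (z : Fin (n + 1)),
    (∀ A ∈ 𝒱, ∀ B ∈ 𝒱, A ∪ B ∈ 𝒱) → (∀ S : Finset (Fin (n + 1)), z ∈ S → S ∈ 𝒢) →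
      BPos (n + 1) (fun w => phiSet (n + 1) (mix 𝒢 𝒱 w)) := by
  intro n
  induction n using Nat.strong_induction_on with
  | _ n ih =>
  intro 𝒢 𝒱 z hV hstar
  -- descend from `univ` to `𝒢 = univ \ D` by deleting the sets of `D` (none of which contains `z`) one at a time
  have descent : ∀ D : Finset (Finset (Fin (n + 1))), (∀ S ∈ D, z ∉ S) →
      BPos (n + 1) (fun w => phiSet (n + 1) (mix (univ \ D) 𝒱 w)) := by
    intro D
    induction D using Finset.induction_on with
    | empty =>
      intro _
      exact (bpos_phiSet_mix_univ 𝒱 hV).congr fun w => by rw [sdiff_empty]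
    | @insert S D hSD ihD =>
      intro hD
      have hzS : z ∉ S := hD S (mem_insert_self _ _)
      have hD' : ∀ S ∈ D, z ∉ S := fun X hX => hD X (mem_insert_of_mem hX)
      have hprev := ihD hD'
      have hSG : S ∈ univ \ D := mem_sdiff.2 ⟨mem_univ _, hSD⟩
      by_cases hSe : S = ∅
      · -- deleting the empty set changes no block value
        refine hprev.congr fun w => ?_
        rw [Finset.sdiff_insert]
        refine PhiScale.phiSet_congr fun B hB => ?_
        have hBS : B ≠ S := by rintro rfl; exact hB.ne_empty hSe
        rw [mix_erase_of_ne hBS w]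
      · obtain ⟨y, hy⟩ := Finset.nonempty_iff_ne_empty.2 hSe
        have hSu : S ≠ univ := fun h => hzS (h ▸ mem_univ z)
        obtain ⟨m, f, hf, hid⟩ := phiSet_mix_erase (univ \ D) 𝒱 hSG hy hSu
        have hm : m < n := lt_of_map_univ_eq_sdiff hy f hf
        -- the restricted pair contains the star of the preimage of `z`
        have hzr : z ∈ (univ : Finset (Fin (m + 1))).map f := by rw [hf]; exact mem_sdiff.2 ⟨mem_univ _, hzS⟩
        obtain ⟨z', _, hz'⟩ := mem_map.1 hzr
        have hstar' : ∀ X : Finset (Fin (m + 1)), z' ∈ X → X ∈ comap f (univ \ D) := by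
          intro X hX
          rw [mem_comap]
          refine mem_sdiff.2 ⟨mem_univ _, fun hXD => hD' _ hXD ?_⟩
          rw [← hz']
          exact mem_map_of_mem f hX
        have hrec := ih m hm (comap f (univ \ D)) (comap f 𝒱) z' (comap_unionClosed f 𝒱 hV) hstar'
        have hprod : BPos (n + 1) (fun w => ((S.card - 1).factorial : ℝ) *
            (w * phiSet (m + 1) (mix (comap f (univ \ D)) (comap f 𝒱) w))) :=
          ((bpos_id.mul hrec).mono (by omega)).smul (Nat.cast_nonneg _)
        refine (hprev.add hprod).congr fun w => ?_
        rw [Finset.sdiff_insert, hid w]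
  have hG : 𝒢 = univ \ (univ \ 𝒢) := by rw [sdiff_sdiff_right_self, Finset.inf_eq_inter, univ_inter]
  rw [hG]
  exact descent (univ \ 𝒢) fun S hS hzS => (mem_sdiff.1 hS).2 (hstar S hzS)

/-- Pointwise corollary: `(UC-hull)` holds on the whole edge `[1_𝒢, 1_𝒱]` for such pairs. [this work] -/
theorem phiSet_mix_nonneg_of_star (𝒢 𝒱 : Finset (Finset (Fin (n + 1)))) (z : Fin (n + 1))
    (hV : ∀ A ∈ 𝒱, ∀ B ∈ 𝒱, A ∪ B ∈ 𝒱) (hstar : ∀ S : Finset (Fin (n + 1)), z ∈ S → S ∈ 𝒢)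
    {w : ℝ} (hw0 : 0 ≤ w) (hw1 : w ≤ 1) : 0 ≤ phiSet (n + 1) (mix 𝒢 𝒱 w) :=
  (bpos_phiSet_mix_of_star n 𝒢 𝒱 z hV hstar).nonneg hw0 hw1

/-- The mirror statement: `𝒰` union-closed, `𝒢 ⊇ star z` in the SECOND slot. [this work] -/
theorem bpos_phiSet_mix_of_star_right (𝒰 𝒢 : Finset (Finset (Fin (n + 1)))) (z : Fin (n + 1))
    (hU : ∀ A ∈ 𝒰, ∀ B ∈ 𝒰, A ∪ B ∈ 𝒰) (hstar : ∀ S : Finset (Fin (n + 1)), z ∈ S → S ∈ 𝒢) :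
    BPos (n + 1) (fun w => phiSet (n + 1) (mix 𝒰 𝒢 w)) :=
  (bpos_phiSet_mix_of_star n 𝒢 𝒰 z hU hstar).reflect.congr fun w => by rw [mix_swap]

end StarAbsorption

end Summit.CriticalPhenomena.PercolationContinuityZ3.Theorems
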